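import Summits.QuantumFields.YangMills.Theorems.ColdStartUniversalityLatticeLangevinSupersolution
import Summits.QuantumFields.YangMills.Theorems.ColdStartUniversalityLatticeLangevinRidgeDense
import Summits.QuantumFields.YangMills.Theorems.ColdStartUniversalityLatticeLangevinMeasureOrder
import Summits.QuantumFields.YangMills.Theorems.ColdStartUniversalityLatticeLangevinDoeblinBetaZero
import Summits.QuantumFields.YangMills.Theorems.ColdStartUniversalityLatticeLangevinDynkinForward
import Summits.QuantumFields.YangMills.Theorems.ColdStartUniversalityUniformColdStartMixingRungOfHarris
import HarnessLib

/-!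
# Route `ColdStartUniversality`, crux K_A1 `UniformColdStartMixing` (stmt-QuantumFields-24809), rung `stub_fixedCutoffMixing`:
# G-block, assembly A1 + A3 — the Doeblin minorisation (D) of the rung at EVERY coupling `β'`

Helper file (seat `ym-line-csu-p1`, g7).  `exists_groundState_bounds`: the ground-state potential `V̂` and the plaquette function
are bounded on the compact `SU(2)^E`.  `integral_le_of_groundState`: for continuous `0 ≤ f ≤ 1`,
`e^{-Kt-M} E f(Y^z_t) ≤ E f(X^z_t)` (`X` the SZZ flow at `β'`, `Y` at `β' = 0`; the supersolution inequality
`groundState_supersolution` extended from latitude eigenfunctions to continuous functions by uniform density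
`exists_ridge_uniform_near`).  `doeblin_szz`: hence the transition kernels at `β'` dominate a multiple of those at `β' = 0`, and
`doeblin_beta_zero` gives hypothesis (D) of `fixedCutoffMixing_of_doeblin` for every `β'` — one of the two walls of the rung.
No definition, no sorry.  RECORD-rung R3 plumbing; the Yang–Mills mass gap is NOT proved here.
-/

set_option autoImplicit false

noncomputable section

namespace Summit.QuantumFields.YangMills.Theorems.ColdStartUniversality

open MeasureTheory ProbabilityTheory Finset Metric Filter
open scoped BigOperators Topology NNReal ENNReal
open Literature.Probability.Process Literature.MathematicalPhysics.QuantumFieldTheory Literature.Analysis.SpecialFunctions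
open Literature.MathematicalPhysics.QuantumLattice (fundamentalRep fundamentalLatticeRep)

variable {L : ℕ} [NeZero L]

/-- **A1. Bounds of the ground-state potential and of the plaquette function on the group** (continuity on the compact
`SU(2)^E`). [folklore] -/
theorem exists_groundState_bounds (β' : ℝ) :
    ∃ K Mψ : ℝ, (Continuous fun V : GaugeConfig 3 L (Matrix.specialUnitaryGroup (Fin 2) ℂ) =>
        (fun y : (Edge 3 L × Fin 2 × Fin 2 × Bool) → ℝ =>
          β' * ∑ p : Plaquette 3 L, (rootedLoop (fun (e : Edge 3 L) (i j : Fin 2) =>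
            ((y (e, i, j, false) : ℝ) : ℂ) + ((y (e, i, j, true) : ℝ) : ℂ) * Complex.I) (p.1, p.2.1.1) p.2.1.2 false).trace.re)
          (fun q : Edge 3 L × Fin 2 × Fin 2 × Bool => (fun z : ℂ => if q.2.2.2 then z.im else z.re)
            ((fundamentalRep (Fin 2) (V q.1) : Matrix (Fin 2) (Fin 2) ℂ) q.2.1 q.2.2.1))) ∧
      ∀ V : GaugeConfig 3 L (Matrix.specialUnitaryGroup (Fin 2) ℂ),
      (let x : (Edge 3 L × Fin 2 × Fin 2 × Bool) → ℝ := fun q =>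
          (fun z : ℂ => if q.2.2.2 then z.im else z.re)
            ((fundamentalRep (Fin 2) (V q.1) : Matrix (Fin 2) (Fin 2) ℂ) q.2.1 q.2.2.1)
       let b₀ : (Edge 3 L × Fin 2 × Fin 2 × Bool) → ℝ := fun q =>
          (fun z : ℂ => if q.2.2.2 then z.im else z.re) ((latticeLangevinDynamics (fundamentalLatticeRep 2) 0).drift
            (matrixConfig (fundamentalRep (Fin 2)) V) q.1 q.2.1 q.2.2.1)
       let σ : (Edge 3 L × Fin 2 × Fin 2 × Bool) → (Edge 3 L × NoiseIdx 2) → ℝ := fun q k =>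
          if k.1 = q.1 then (fun z : ℂ => if q.2.2.2 then z.im else z.re)
            ((latticeLangevinDynamics (fundamentalLatticeRep 2) 0).noise
              (matrixConfig (fundamentalRep (Fin 2)) V) q.1 k.2 q.2.1 q.2.2.1) else 0
       let ψ : ((Edge 3 L × Fin 2 × Fin 2 × Bool) → ℝ) → ℝ := fun y =>
          β' * ∑ p : Plaquette 3 L, (rootedLoop (fun (e : Edge 3 L) (i j : Fin 2) =>
            ((y (e, i, j, false) : ℝ) : ℂ) + ((y (e, i, j, true) : ℝ) : ℂ) * Complex.I) (p.1, p.2.1.1) p.2.1.2 false).trace.re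
       1 / 2 * (∑ i, fderiv ℝ ψ x (Pi.single i 1) * b₀ i +
            1 / 2 * ∑ i, ∑ j, fderiv ℝ (fun z => fderiv ℝ ψ z (Pi.single i 1)) x (Pi.single j 1) * ∑ n, σ i n * σ j n) +
          1 / 8 * ∑ i, ∑ j, fderiv ℝ ψ x (Pi.single i 1) * fderiv ℝ ψ x (Pi.single j 1) * ∑ n, σ i n * σ j n ≤ K) ∧
      |(fun y : (Edge 3 L × Fin 2 × Fin 2 × Bool) → ℝ =>
          β' * ∑ p : Plaquette 3 L, (rootedLoop (fun (e : Edge 3 L) (i j : Fin 2) =>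
            ((y (e, i, j, false) : ℝ) : ℂ) + ((y (e, i, j, true) : ℝ) : ℂ) * Complex.I) (p.1, p.2.1.1) p.2.1.2 false).trace.re)
          (fun q : Edge 3 L × Fin 2 × Fin 2 × Bool => (fun z : ℂ => if q.2.2.2 then z.im else z.re)
            ((fundamentalRep (Fin 2) (V q.1) : Matrix (Fin 2) (Fin 2) ℂ) q.2.1 q.2.2.1))| ≤ Mψ := by
  classical
  let ψ : ((Edge 3 L × Fin 2 × Fin 2 × Bool) → ℝ) → ℝ := fun y =>
      β' * ∑ p : Plaquette 3 L, (rootedLoop (fun (e : Edge 3 L) (i j : Fin 2) =>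
        ((y (e, i, j, false) : ℝ) : ℂ) + ((y (e, i, j, true) : ℝ) : ℂ) * Complex.I) (p.1, p.2.1.1) p.2.1.2 false).trace.re
  have hψ2 : ContDiff ℝ 2 ψ := contDiff_psiHat (d := 3) (L := L) (N := 2) (n := 2) β'
  have hco := continuous_coords (L := L)
  have hψV := hψ2.continuous.comp hco
  -- continuity of the generator part and of the carré du champ
  have hG := continuous_generator (L := L) 0 (f := ψ) hψ2
  have hd1 : ∀ v, Continuous fun y : Edge 3 L × Fin 2 × Fin 2 × Bool → ℝ => fderiv ℝ ψ y v := fun v =>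
    (hψ2.continuous_fderiv (by norm_num)).clm_apply continuous_const
  have hnoise : ∀ (i : Edge 3 L × Fin 2 × Fin 2 × Bool) (n : Edge 3 L × NoiseIdx 2), Continuous fun V : GaugeConfig 3 L
      (Matrix.specialUnitaryGroup (Fin 2) ℂ) => (if n.1 = i.1 then (fun z : ℂ => if i.2.2.2 then z.im else z.re)
        ((latticeLangevinDynamics (fundamentalLatticeRep 2) 0).noise (matrixConfig (fundamentalRep (Fin 2)) V)
          i.1 n.2 i.2.1 i.2.2.1) else 0) := by
    intro i n
    by_cases h : n.1 = i.1
    · simp only [if_pos h]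
      have hc := (continuous_apply i.2.2.1).comp ((continuous_apply i.2.1).comp (continuous_noise_matrixConfig (L := L) 0 i.1 n.2))
      cases i.2.2.2
      · exact Complex.continuous_re.comp hc
      · exact Complex.continuous_im.comp hc
    · simp only [if_neg h]; exact continuous_const
  have hΓ : Continuous fun V : GaugeConfig 3 L (Matrix.specialUnitaryGroup (Fin 2) ℂ) =>
      ∑ i : Edge 3 L × Fin 2 × Fin 2 × Bool, ∑ j : Edge 3 L × Fin 2 × Fin 2 × Bool,
        fderiv ℝ ψ (fun q : Edge 3 L × Fin 2 × Fin 2 × Bool => (fun z : ℂ => if q.2.2.2 then z.im else z.re)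
            ((fundamentalRep (Fin 2) (V q.1) : Matrix (Fin 2) (Fin 2) ℂ) q.2.1 q.2.2.1)) (Pi.single i 1) *
          fderiv ℝ ψ (fun q : Edge 3 L × Fin 2 × Fin 2 × Bool => (fun z : ℂ => if q.2.2.2 then z.im else z.re)
            ((fundamentalRep (Fin 2) (V q.1) : Matrix (Fin 2) (Fin 2) ℂ) q.2.1 q.2.2.1)) (Pi.single j 1) *
          ∑ n : Edge 3 L × NoiseIdx 2,
            (if n.1 = i.1 then (fun z : ℂ => if i.2.2.2 then z.im else z.re)
              ((latticeLangevinDynamics (fundamentalLatticeRep 2) 0).noise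
                (matrixConfig (fundamentalRep (Fin 2)) V) i.1 n.2 i.2.1 i.2.2.1) else 0) *
            (if n.1 = j.1 then (fun z : ℂ => if j.2.2.2 then z.im else z.re)
              ((latticeLangevinDynamics (fundamentalLatticeRep 2) 0).noise
                (matrixConfig (fundamentalRep (Fin 2)) V) j.1 n.2 j.2.1 j.2.2.1) else 0) := by
    refine continuous_finsetSum _ fun i _ => continuous_finsetSum _ fun j _ => ?_
    exact (((hd1 _).comp hco).mul ((hd1 _).comp hco)).mul (continuous_finsetSum _ fun n _ => (hnoise i n).mul (hnoise j n))
  have hV := ((continuous_const (y := (1 / 2 : ℝ))).mul hG).add ((continuous_const (y := (1 / 8 : ℝ))).mul hΓ)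
  obtain ⟨K, -, hK⟩ := exists_abs_le_of_continuous hV
  obtain ⟨Mψ, -, hM⟩ := exists_abs_le_of_continuous hψV
  refine ⟨K, Mψ, hψV, fun V => ⟨?_, hM V⟩⟩
  dsimp only
  exact (le_abs_self _).trans (hK V)


/-- **A3a. From latitude eigenfunctions to continuous functions**: for continuous `0 ≤ f ≤ 1`,
`e^{-Kt-M} E f(Y^z_t) ≤ E f(X^z_t)` (`X` the SZZ flow at `β'`, `Y` at `β' = 0`, both with the regular-flow clause;
`K`, `M` the bounds of `exists_groundState_bounds`). [folklore] -/
theorem integral_le_of_groundState (β' : ℝ)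
    {Ω : Type} [MeasurableSpace Ω] {P : Measure Ω} [IsProbabilityMeasure P]
    {W : ℝ≥0 → Ω → (Edge 3 L × NoiseIdx 2 → ℝ)} (hW : IsFlatBrownian W P)
    (U : GaugeConfig 3 L (Matrix.specialUnitaryGroup (Fin 2) ℂ) → ℝ≥0 → Ω →
      GaugeConfig 3 L (Matrix.specialUnitaryGroup (Fin 2) ℂ))
    (hU : ∀ x, (∀ ω, U x 0 ω = x) ∧
      (latticeLangevinDynamics (fundamentalLatticeRep 2) β').IsSolution (fundamentalRep (Fin 2))
        hW.natFiltration P W (U x))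
    (hUm : ∀ i : ℝ≥0, Measurable[@Prod.instMeasurableSpace (Set.Iic i)
        (GaugeConfig 3 L (Matrix.specialUnitaryGroup (Fin 2) ℂ) × Ω) inferInstance
        (@Prod.instMeasurableSpace (GaugeConfig 3 L (Matrix.specialUnitaryGroup (Fin 2) ℂ)) Ω inferInstance
          (hW.natFiltration i))]
      (fun q : Set.Iic i × (GaugeConfig 3 L (Matrix.specialUnitaryGroup (Fin 2) ℂ) × Ω) => U q.2.1 q.1 q.2.2))
    {Ω' : Type} [MeasurableSpace Ω'] {P' : Measure Ω'} [IsProbabilityMeasure P']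
    {W' : ℝ≥0 → Ω' → (Edge 3 L × NoiseIdx 2 → ℝ)} (hW' : IsFlatBrownian W' P')
    (Y : GaugeConfig 3 L (Matrix.specialUnitaryGroup (Fin 2) ℂ) → ℝ≥0 → Ω' →
      GaugeConfig 3 L (Matrix.specialUnitaryGroup (Fin 2) ℂ))
    (hY : ∀ x, (∀ ω, Y x 0 ω = x) ∧
      (latticeLangevinDynamics (fundamentalLatticeRep 2) 0).IsSolution (fundamentalRep (Fin 2))
        hW'.natFiltration P' W' (Y x))
    (hYm : ∀ i : ℝ≥0, Measurable[@Prod.instMeasurableSpace (Set.Iic i)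
        (GaugeConfig 3 L (Matrix.specialUnitaryGroup (Fin 2) ℂ) × Ω') inferInstance
        (@Prod.instMeasurableSpace (GaugeConfig 3 L (Matrix.specialUnitaryGroup (Fin 2) ℂ)) Ω' inferInstance
          (hW'.natFiltration i))]
      (fun q : Set.Iic i × (GaugeConfig 3 L (Matrix.specialUnitaryGroup (Fin 2) ℂ) × Ω') => Y q.2.1 q.1 q.2.2))
    {f : GaugeConfig 3 L (Matrix.specialUnitaryGroup (Fin 2) ℂ) → ℝ} (hf : Continuous f) (hf0 : ∀ V, 0 ≤ f V)
    (hf1 : ∀ V, f V ≤ 1) (z : GaugeConfig 3 L (Matrix.specialUnitaryGroup (Fin 2) ℂ)) (t : ℝ≥0) :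
    ∃ K Mψ : ℝ, (∀ (f' : GaugeConfig 3 L (Matrix.specialUnitaryGroup (Fin 2) ℂ) → ℝ), Continuous f' → (∀ V, 0 ≤ f' V) →
      (∀ V, f' V ≤ 1) → ∀ (z' : GaugeConfig 3 L (Matrix.specialUnitaryGroup (Fin 2) ℂ)) (t' : ℝ≥0),
        Real.exp (-(K * t') - Mψ) * ∫ ω', f' (Y z' t' ω') ∂P' ≤ ∫ ω, f' (U z' t' ω) ∂P) ∧
      Real.exp (-(K * t) - Mψ) * ∫ ω', f (Y z t ω') ∂P' ≤ ∫ ω, f (U z t ω) ∂P := by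
  classical
  haveI := secondCountableTopology_su2
  haveI := borelSpace_config L
  obtain ⟨K, Mψ, hψc, hKM⟩ := exists_groundState_bounds (L := L) β'
  -- the plaquette function on the group and the ground state
  set ψV : GaugeConfig 3 L (Matrix.specialUnitaryGroup (Fin 2) ℂ) → ℝ := fun V =>
      β' * ∑ p : Plaquette 3 L, (rootedLoop (fun (e : Edge 3 L) (i j : Fin 2) =>
        ((((fundamentalRep (Fin 2) (V e) : Matrix (Fin 2) (Fin 2) ℂ) i j).re : ℝ) : ℂ) +
          ((((fundamentalRep (Fin 2) (V e) : Matrix (Fin 2) (Fin 2) ℂ) i j).im : ℝ) : ℂ) * Complex.I)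
        (p.1, p.2.1.1) p.2.1.2 false).trace.re with hψVdef
  set φ : GaugeConfig 3 L (Matrix.specialUnitaryGroup (Fin 2) ℂ) → ℝ := fun V => Real.exp (-(1 / 2 : ℝ) * ψV V) with hφdef
  have hφc : Continuous φ := Real.continuous_exp.comp (continuous_const.mul hψc)
  have hφpos : ∀ V, 0 < φ V := fun V => Real.exp_pos _
  have hψVeq : ∀ V : GaugeConfig 3 L (Matrix.specialUnitaryGroup (Fin 2) ℂ), ψV V =
      (fun y : (Edge 3 L × Fin 2 × Fin 2 × Bool) → ℝ =>
          β' * ∑ p : Plaquette 3 L, (rootedLoop (fun (e : Edge 3 L) (i j : Fin 2) =>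
            ((y (e, i, j, false) : ℝ) : ℂ) + ((y (e, i, j, true) : ℝ) : ℂ) * Complex.I) (p.1, p.2.1.1) p.2.1.2 false).trace.re)
          (fun q : Edge 3 L × Fin 2 × Fin 2 × Bool => (fun z : ℂ => if q.2.2.2 then z.im else z.re)
            ((fundamentalRep (Fin 2) (V q.1) : Matrix (Fin 2) (Fin 2) ℂ) q.2.1 q.2.2.1)) := fun V => rfl
  have hψVabs : ∀ V, |ψV V| ≤ Mψ := fun V => by rw [hψVeq]; exact (hKM V).2
  have hφup : ∀ V, φ V ≤ Real.exp (Mψ / 2) := fun V => by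
    rw [hφdef]; apply Real.exp_le_exp.2
    have := (abs_le.1 (hψVabs V)).1; linarith
  have hφlow : ∀ V, Real.exp (-(Mψ / 2)) ≤ φ V := fun V => by
    rw [hφdef]; apply Real.exp_le_exp.2
    have := (abs_le.1 (hψVabs V)).2; linarith
  -- the core statement for an arbitrary continuous `0 ≤ f' ≤ 1`
  have hcore : ∀ (f' : GaugeConfig 3 L (Matrix.specialUnitaryGroup (Fin 2) ℂ) → ℝ), Continuous f' → (∀ V, 0 ≤ f' V) →
      (∀ V, f' V ≤ 1) → ∀ (z' : GaugeConfig 3 L (Matrix.specialUnitaryGroup (Fin 2) ℂ)) (t' : ℝ≥0),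
      Real.exp (-(K * t') - Mψ) * ∫ ω', f' (Y z' t' ω') ∂P' ≤ ∫ ω, f' (U z' t' ω) ∂P := by
    intro f' hf' hf'0 hf'1 z' t'
    -- measurability / integrability boilerplate
    have hmU : Measurable (U z' t') := ((hU z').2.adapted t').mono (hW.natFiltration.le t') le_rfl
    have hmY : Measurable (Y z' t') := ((hY z').2.adapted t').mono (hW'.natFiltration.le t') le_rfl
    have hint : ∀ {g : GaugeConfig 3 L (Matrix.specialUnitaryGroup (Fin 2) ℂ) → ℝ}, Continuous g →
        Integrable (fun ω => g (U z' t' ω)) P ∧ Integrable (fun ω' => g (Y z' t' ω')) P' := by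
      intro g hg
      obtain ⟨M, -, hM⟩ := exists_abs_le_of_continuous hg
      exact ⟨Integrable.of_bound (hg.measurable.comp hmU).aestronglyMeasurable M
          (Eventually.of_forall fun ω => by rw [Real.norm_eq_abs]; exact hM _),
        Integrable.of_bound (hg.measurable.comp hmY).aestronglyMeasurable M
          (Eventually.of_forall fun ω => by rw [Real.norm_eq_abs]; exact hM _)⟩
    -- `G = f'/φ`
    set G : GaugeConfig 3 L (Matrix.specialUnitaryGroup (Fin 2) ℂ) → ℝ := fun V => f' V / φ V with hGdef
    have hGc : Continuous G := hf'.div hφc fun V => (hφpos V).ne'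
    have hG0 : ∀ V, 0 ≤ G V := fun V => div_nonneg (hf'0 V) (hφpos V).le
    have hφG : ∀ V, φ V * G V = f' V := fun V => by rw [hGdef]; field_simp [(hφpos V).ne']
    have hGlow : ∀ V, Real.exp (-(Mψ / 2)) * f' V ≤ G V := by
      intro V
      rw [hGdef, le_div_iff₀ (hφpos V)]
      calc Real.exp (-(Mψ / 2)) * f' V * φ V = (Real.exp (-(Mψ / 2)) * φ V) * f' V := by ring
        _ ≤ 1 * f' V := by
            refine mul_le_mul_of_nonneg_right ?_ (hf'0 V)
            calc Real.exp (-(Mψ / 2)) * φ V ≤ Real.exp (-(Mψ / 2)) * Real.exp (Mψ / 2) :=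
                  mul_le_mul_of_nonneg_left (hφup V) (Real.exp_pos _).le
              _ = 1 := by rw [← Real.exp_add]; simp
        _ = f' V := one_mul _
    -- approximation by latitude eigenfunctions, keeping nonnegativity
    have hmain : ∀ ε : ℝ, 0 < ε →
        φ z' * ∫ ω', G (Y z' t' ω') ∂P' ≤ Real.exp (K * t') * (∫ ω, f' (U z' t' ω) ∂P + 2 * ε * Real.exp (Mψ / 2)) := by
      intro ε hε
      obtain ⟨κ, hκ, c, g, m, hF⟩ := exists_ridge_uniform_near (L := L) hGc hε
      obtain ⟨κ', hκ', c', g', m', hF'⟩ := exists_ridge_add ⟨κ, hκ, c, g, m, fun V => rfl⟩ (exists_ridge_const (L := L) ε)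
      -- `F' = F + ε ≥ 0`
      have hF'0 : ∀ V : GaugeConfig 3 L (Matrix.specialUnitaryGroup (Fin 2) ℂ), 0 ≤ ∑ l, c' l * ∏ e, gegenbauerSum 1 (m' l e)
          (hsForm 2 (fundamentalRep (Fin 2) (g' l e)) (fundamentalRep (Fin 2) (V e)) / 2) := by
        intro V; rw [← hF' V]
        have := (abs_lt.1 (hF V)).1
        linarith [hG0 V]
      have hF'G : ∀ V : GaugeConfig 3 L (Matrix.specialUnitaryGroup (Fin 2) ℂ),
          G V ≤ ∑ l, c' l * ∏ e, gegenbauerSum 1 (m' l e)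
            (hsForm 2 (fundamentalRep (Fin 2) (g' l e)) (fundamentalRep (Fin 2) (V e)) / 2) ∧
          ∑ l, c' l * ∏ e, gegenbauerSum 1 (m' l e)
            (hsForm 2 (fundamentalRep (Fin 2) (g' l e)) (fundamentalRep (Fin 2) (V e)) / 2) ≤ G V + 2 * ε := by
        intro V; rw [← hF' V]
        have h := abs_lt.1 (hF V)
        constructor <;> linarith [h.1, h.2]
      have hsuper := groundState_supersolution (L := L) β' hW U hU hUm hW' Y hY hYm c' g' m' hF'0 K
        (fun V => (hKM V).1) z' t'
      dsimp only at hsuper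
      -- the ridge function is continuous
      have hRc : Continuous fun V : GaugeConfig 3 L (Matrix.specialUnitaryGroup (Fin 2) ℂ) =>
          ∑ l, c' l * ∏ e, gegenbauerSum 1 (m' l e)
            (hsForm 2 (fundamentalRep (Fin 2) (g' l e)) (fundamentalRep (Fin 2) (V e)) / 2) :=
        continuous_finsetSum _ fun l _ => continuous_const.mul (continuous_prod_gegenbauer_latitude (L := L) (g' l) (m' l))
      -- compare the two sides
      have hleft : φ z' * ∫ ω', G (Y z' t' ω') ∂P' ≤ φ z' * ∫ ω', (∑ l, c' l * ∏ e, gegenbauerSum 1 (m' l e)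
          (hsForm 2 (fundamentalRep (Fin 2) (g' l e)) (fundamentalRep (Fin 2) (Y z' t' ω' e)) / 2)) ∂P' := by
        refine mul_le_mul_of_nonneg_left (integral_mono (hint hGc).2 (hint hRc).2 fun ω' => (hF'G _).1) (hφpos z').le
      have hright : ∫ ω, φ (U z' t' ω) * (∑ l, c' l * ∏ e, gegenbauerSum 1 (m' l e)
          (hsForm 2 (fundamentalRep (Fin 2) (g' l e)) (fundamentalRep (Fin 2) (U z' t' ω e)) / 2)) ∂P ≤
          ∫ ω, f' (U z' t' ω) ∂P + 2 * ε * Real.exp (Mψ / 2) := by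
        have h1 : ∫ ω, φ (U z' t' ω) * (∑ l, c' l * ∏ e, gegenbauerSum 1 (m' l e)
            (hsForm 2 (fundamentalRep (Fin 2) (g' l e)) (fundamentalRep (Fin 2) (U z' t' ω e)) / 2)) ∂P ≤
            ∫ ω, (f' (U z' t' ω) + 2 * ε * Real.exp (Mψ / 2)) ∂P := by
          refine integral_mono (hint (hφc.mul hRc)).1 ((hint hf').1.add (integrable_const _)) fun ω => ?_
          have hV := (hF'G (U z' t' ω)).2
          have hφV := hφpos (U z' t' ω)
          calc φ (U z' t' ω) * _ ≤ φ (U z' t' ω) * (G (U z' t' ω) + 2 * ε) := mul_le_mul_of_nonneg_left hV hφV.le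
            _ = f' (U z' t' ω) + φ (U z' t' ω) * (2 * ε) := by rw [mul_add, hφG]
            _ ≤ f' (U z' t' ω) + Real.exp (Mψ / 2) * (2 * ε) := by
                have := mul_le_mul_of_nonneg_right (hφup (U z' t' ω)) (by positivity : (0 : ℝ) ≤ 2 * ε)
                linarith
            _ = f' (U z' t' ω) + 2 * ε * Real.exp (Mψ / 2) := by ring
        rw [integral_add (hint hf').1 (integrable_const _), integral_const, smul_eq_mul, probReal_univ, one_mul] at h1
        exact h1
      calc φ z' * ∫ ω', G (Y z' t' ω') ∂P' ≤ _ := hleft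
        _ ≤ Real.exp (K * t') * ∫ ω, φ (U z' t' ω) * (∑ l, c' l * ∏ e, gegenbauerSum 1 (m' l e)
            (hsForm 2 (fundamentalRep (Fin 2) (g' l e)) (fundamentalRep (Fin 2) (U z' t' ω e)) / 2)) ∂P := hsuper
        _ ≤ Real.exp (K * t') * (∫ ω, f' (U z' t' ω) ∂P + 2 * ε * Real.exp (Mψ / 2)) :=
            mul_le_mul_of_nonneg_left hright (Real.exp_pos _).le
    -- let `ε → 0`
    have hlim : φ z' * ∫ ω', G (Y z' t' ω') ∂P' ≤ Real.exp (K * t') * ∫ ω, f' (U z' t' ω) ∂P := by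
      refine le_of_forall_pos_le_add fun δ hδ => ?_
      have hpos : 0 < 2 * Real.exp (K * t') * Real.exp (Mψ / 2) := by positivity
      have h := hmain (δ / (2 * Real.exp (K * t') * Real.exp (Mψ / 2))) (div_pos hδ hpos)
      have heq : Real.exp (K * t') * (∫ ω, f' (U z' t' ω) ∂P + 2 * (δ / (2 * Real.exp (K * t') * Real.exp (Mψ / 2))) *
          Real.exp (Mψ / 2)) = Real.exp (K * t') * ∫ ω, f' (U z' t' ω) ∂P + δ := by
        field_simp
      linarith [h, heq]
    -- unwind `G` and `φ`
    have hGint : Real.exp (-(Mψ / 2)) * ∫ ω', f' (Y z' t' ω') ∂P' ≤ ∫ ω', G (Y z' t' ω') ∂P' := by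
      rw [← MeasureTheory.integral_const_mul]
      exact integral_mono ((hint hf').2.const_mul _) (hint hGc).2 fun ω' => hGlow _
    have hf'int0 : 0 ≤ ∫ ω', f' (Y z' t' ω') ∂P' := integral_nonneg fun ω' => hf'0 _
    have hchain : Real.exp (-(Mψ / 2)) * (Real.exp (-(Mψ / 2)) * ∫ ω', f' (Y z' t' ω') ∂P') ≤
        Real.exp (K * t') * ∫ ω, f' (U z' t' ω) ∂P :=
      calc Real.exp (-(Mψ / 2)) * (Real.exp (-(Mψ / 2)) * ∫ ω', f' (Y z' t' ω') ∂P')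
            ≤ φ z' * ∫ ω', G (Y z' t' ω') ∂P' :=
              mul_le_mul (hφlow z') hGint (mul_nonneg (Real.exp_pos _).le hf'int0) (hφpos z').le
        _ ≤ Real.exp (K * t') * ∫ ω, f' (U z' t' ω) ∂P := hlim
    have hexp : Real.exp (-(K * t') - Mψ) = (Real.exp (K * t'))⁻¹ * (Real.exp (-(Mψ / 2)) * Real.exp (-(Mψ / 2))) := by
      rw [← Real.exp_neg, ← Real.exp_add, ← Real.exp_add]; congr 1; ring
    rw [hexp, mul_assoc, mul_assoc, inv_mul_le_iff₀ (Real.exp_pos _)]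
    exact hchain
  exact ⟨K, Mψ, hcore, hcore f hf hf0 hf1 z t⟩

/-- **A3. The Doeblin minorisation (D) of the rung at every coupling**: the transition kernels of the SU(2) lattice
Langevin dynamics at `β'` dominate a common nonzero measure at some time `t₀` — hypothesis (D) of
`fixedCutoffMixing_of_doeblin`, for all `β'` (at `β' = 0`: `doeblin_beta_zero`). [folklore] -/
theorem doeblin_szz (β' : ℝ)
    (κ : ℝ≥0 → Kernel (GaugeConfig 3 L (Matrix.specialUnitaryGroup (Fin 2) ℂ))
      (GaugeConfig 3 L (Matrix.specialUnitaryGroup (Fin 2) ℂ))) [∀ t, IsMarkovKernel (κ t)]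
    (hreal : ∀ (t : ℝ≥0) (x : GaugeConfig 3 L (Matrix.specialUnitaryGroup (Fin 2) ℂ))
        (Ω : Type) [MeasurableSpace Ω] (P : Measure Ω) [IsProbabilityMeasure P]
        (W : ℝ≥0 → Ω → (Edge 3 L × NoiseIdx 2 → ℝ)) (hW : IsFlatBrownian W P)
        (U : ℝ≥0 → Ω → GaugeConfig 3 L (Matrix.specialUnitaryGroup (Fin 2) ℂ)),
        (∀ ω, U 0 ω = x) →
        (latticeLangevinDynamics (fundamentalLatticeRep 2) β').IsSolution (fundamentalRep (Fin 2))
          hW.natFiltration P W U →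
        κ t x = P.map (U t)) :
    ∃ (t₀ : ℝ≥0) (ν : Measure (GaugeConfig 3 L (Matrix.specialUnitaryGroup (Fin 2) ℂ))),
      ν ≠ 0 ∧ ∀ z, ν ≤ κ t₀ z := by
  classical
  haveI := secondCountableTopology_su2
  haveI := borelSpace_config L
  obtain ⟨κ₀, hκ₀, -, hreal₀⟩ := exists_transitionKernel L 0
  haveI := hκ₀
  obtain ⟨t₀, ν, hν, hle⟩ := doeblin_beta_zero (L := L) κ₀ hreal₀
  -- the two flows on the product Wiener space
  haveI := isProbabilityMeasure_piWiener (Edge 3 L × NoiseIdx 2)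
  have hWc := isFlatBrownian_piWiener 3 L (NoiseIdx 2)
  obtain ⟨X, GX, hX, hXm, -, -, -⟩ := exists_regularFlow L β' hWc
  obtain ⟨Y, GY, hY, hYm, -, -, -⟩ := exists_regularFlow L 0 hWc
  obtain ⟨K, Mψ, hcore, -⟩ := integral_le_of_groundState (L := L) β' hWc X hX hXm hWc Y hY hYm
    (f := fun _ => (0 : ℝ)) continuous_const (fun _ => le_rfl) (fun _ => zero_le_one) (fun _ => 1) t₀
  set cst : ℝ := Real.exp (-(K * t₀) - Mψ) with hcst
  have hcpos : 0 < cst := Real.exp_pos _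
  refine ⟨t₀, (ENNReal.ofReal cst) • ν, ?_, fun z => ?_⟩
  · intro h0
    apply hν
    have h1 : (ENNReal.ofReal cst)⁻¹ • ((ENNReal.ofReal cst) • ν) = 0 := by rw [h0, smul_zero]
    rwa [smul_smul, ENNReal.inv_mul_cancel (by simpa using hcpos) ENNReal.ofReal_ne_top, one_smul] at h1
  · have hdom : (ENNReal.ofReal cst) • κ₀ t₀ z ≤ κ t₀ z := by
      rw [hreal t₀ z _ _ _ hWc (X z) (hX z).1 (hX z).2, hreal₀ t₀ z _ _ _ hWc (Y z) (hY z).1 (hY z).2]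
      have hmX : Measurable (X z t₀) := ((hX z).2.adapted t₀).mono (hWc.natFiltration.le t₀) le_rfl
      have hmY : Measurable (Y z t₀) := ((hY z).2.adapted t₀).mono (hWc.natFiltration.le t₀) le_rfl
      refine smul_measure_le_of_forall_integral_le hcpos.le fun f hf h0 h1 => ?_
      rw [integral_map hmY.aemeasurable hf.aestronglyMeasurable, integral_map hmX.aemeasurable hf.aestronglyMeasurable]
      exact hcore f hf h0 h1 z t₀
    calc (ENNReal.ofReal cst) • ν ≤ (ENNReal.ofReal cst) • κ₀ t₀ z := by
          have hz := hle z
          rw [Measure.le_iff] at hz ⊢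
          intro s hs
          simp only [Measure.smul_apply, smul_eq_mul]
          exact mul_le_mul_right (hz s hs) _
      _ ≤ κ t₀ z := hdom

end Summit.QuantumFields.YangMills.Theorems.ColdStartUniversality

end
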